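import Summits.QuantumFields.YangMills.Theorems.UnitScaleTiltProp7FibreLevelMass
import Summits.QuantumFields.YangMills.Theorems.UnitScaleTiltProp7FibreLevelMassInduction
import Summits.QuantumFields.YangMills.Theorems.UnitScaleTiltProp7FibreLevelMassT3Letters
import HarnessLib

/-!
# Route `UnitScaleTilt`, crux K1 «MinimiserStabilityRegPr» (stmt-QuantumFields-19200), route-R [RP] curved — THE FIBRE CORE'S RESIDUAL (B7) AT d = 3, `SU(2)`:
# THE TRUE-AVERAGE CONSTRAINT BUDGET `Z_Q` OF ✓ `…CurvedLandauCoreFinalT3` WITHOUT ANY `ℓ²`-MASS INPUT —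
# `Σ_c‖Q^{(K−n)}(WU₀* − 1)(c)‖² ≤ 24ℓ·(200L⁴(CURL+DIV) + 4·10⁹L⁹εℓ⁻²Σ‖Y‖²) + 10⁶L⁴θ²·ℓ⁻¹Σ‖Y‖²` on the (0.4)-fibre, from the per-level sups `μ_j` alone

Cell `ym3-torus`, D-0154 (3c) twin-width seat `ym-routeR-w3` (gen 2); sequel of ✓ `…Prop7FibreLevelMass` (structure rows at every level), ✓ `…Prop7FibreLevelMassInduction`
(the scalar induction) and ✓ `…Prop7FibreLevelMassT3Letters` (d = 3 numerals, (R-B) at every level).  THEOREMS ONLY (0 `def`, 0 `sorry`); `--supports stmt-QuantumFields-19200`,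
count-neutral.  YM₃ on T³ is a ladder rung (R3), not the Clay problem; nothing here claims the stub, the crux, d = 4 or the mass gap.

THE POINT.  ✓ p622368 `Prop7CurvedLandauCoreFinalT3.sum_normSq_le_curl_sq_core_of_fibre_T3'` carries the explicit term `Z_Q = (E_kS_k + 2√dΣ_{j<k}C_CM E_jS_j)²`,
`S_j = Σ_{i<j}ρ^{j−1−i}·260μ_i·C₁·‖Y_i‖_{ℓ²}`, whose `ℓ²` MASSES `‖Y_i‖_{ℓ²}` of the nonlinear level ratios were the census's residual (B7).  Here they are DISCHARGED: at every
level `l ≤ K − n` the structure row ✓ `Prop7FibreLevelMass.sqrt_sum_normSq_levelRatio_le` holds with the SAME tower letters (the sizes `a_j`, `a′ = 4ε` are defined relative to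
the top scale, so a level-`l` instance is a restriction), the coarse gauge function obeys ✓ `…T3Letters.sum_normSq_covIterLambda_le_level` (`Σ_y‖Λ_l y‖² ≤ Lˡ·B²`,
`B² = 200L⁴(CURL+DIV) + 4·10⁹L⁹εℓ⁻²Σ‖Y‖²`, so `ρˡ‖Λ_l‖ ≤ B` since `ρ²L = 1`), and the scalar induction ✓ `levelMass_induction` closes the triangular system under the
(B6)-shape hypothesis `7800·L³·ℓ·μ_j ≤ θ·Lʲ` (i.e. `260μ_jC₁ ≤ θρ^{2(k−j)}`, `C₁ ≤ 30L³`) and ONE k-uniform smallness `1000·θ·L ≤ 1`; the fibre identity then enters ONCE,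
through ✓ `Prop7FibreTrueLinDefectMass.sqrt_sum_normSq_trueLinIter_le_of_iter_eq_mass` (`√Z_Q ≤ E_kS_k + …`), and the end-game numerals (`…T3Letters.endgame`) give the title.
With ★routeR-w1 g2's two-block sup supplier (`μ_j = 4d(d+1)(d+2)L^{d+1}·Lʲ·ρ_W`) the hypothesis reads `θ = 1 872 000·L⁷·(ℓρ_W)`.

WHAT IS PROVED (ns `…Theorems.Prop7FibreLevelMassT3`): ★★★ `sum_normSq_trueLinIter_le_explicit_T3`.
HONEST SCOPE.  A knit: every analytic input is a cited tree theorem; the constants are generous numerals, k- and volume-independent.  Still displayed (named suppliers): the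
(14)-type plaquette bound of `U₀`, the fibre identity, the recursion families (zero content), and the per-level two-block sups `μ_j` with their (B6)-shape bound (★routeR-w1 g2's
`Prop7FibreLevelSupLocalGauge.twoBlockMass_le_of_plaqBound`).

References: T. Bałaban, CMP 98 (1985) 17–51 [Balaban1985Averaging] (Prop. 3 (122)–(126) p.36); CMP 95 (1984) 17–40 [Balaban1984PropagatorsI] ((1.18)–(1.20) pp.19–20);
CMP 99 (1985) 389–434 [Balaban1985BackgroundPropagators] (Thm 3.11 p.416); CMP 102 (1985) 277–309 [Balaban1985Variational] ((14)–(15) p.280, Prop. 7 p.299).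
-/

set_option autoImplicit false

noncomputable section

open scoped BigOperators Matrix.Norms.L2Operator Matrix

namespace Summit.QuantumFields.YangMills.Theorems.Prop7FibreLevelMassT3

open Literature.MathematicalPhysics.QuantumFieldTheory.Balaban1983to89
open Literature.MathematicalPhysics.QuantumFieldTheory.Balaban1983to89.T3ContinuumYM3Torus
open Finset T4Continuum T4ReflectionCone BlockAveraging AveragingRT ExpMeanLog BlockAveragingEMLLinearised BlockAveragingEMLLinearisedBackground
  BlockAveragingEMLProp2 B1RG242Torus
open B9Eq39Adjoint (curl divB)
open B10Eq27TorusAxialLog (holT unitsField toUField)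
open B9TorusCalculus (torusT)
open Summit.QuantumFields.YangMills.Theorems.Prop7CurvedLandauKnitT3 (smallness_T3 three_le_L)
open Summit.QuantumFields.YangMills.Theorems.Prop7CurvedLandauRowE (loop_size_geom size_numerals kappa_eq_mul_rho sum_range_pow_div_le_third exp_third_le)
open Summit.QuantumFields.YangMills.Theorems.Prop7CovIterLambdaBound (tower_plaq_lt plaqSmall_of_le_of_lt)
open Summit.QuantumFields.YangMills.Theorems.Prop7CovIterLambdaHLambdaCurl (sum_normSq_covIterLambda_le_curl_T3_su2)
open Summit.QuantumFields.YangMills.Theorems.Prop7FibreTrueLinDefectMass (sqrt_sum_normSq_trueLinIter_le_of_iter_eq_mass)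
open Summit.QuantumFields.YangMills.Theorems.Prop7FibreLevelMass (sqrt_sum_normSq_levelRatio_le)
open Summit.QuantumFields.YangMills.Theorems.Prop7FibreLevelMassInduction (levelMass_induction)
open Summit.QuantumFields.YangMills.Theorems.Prop7FibreLevelMassT3Letters (rho_facts two_sqrt_d_facts c1_le K0_nonneg K0_le theta_smallness coeff_of_B6
  level_exp_le rho_pow_mul_sqrt_le sq_le_of_rho_pow_mul_le endgame sum_normSq_covIterLambda_le_level)

/-! ## ★★★ The `Z_Q` budget on the fibre, no `ℓ²`-mass input -/

set_option maxHeartbeats 400000 in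
/-- ★★★ **THE TRUE-AVERAGE CONSTRAINT BUDGET ON THE (0.4)-FIBRE FROM THE PER-LEVEL SUPS ALONE (d = 3, `SU(2)`).**  `U₀, W` on the finest torus of run `K`,
`W̄^{(K−n)} = Ū₀^{(K−n)}`; `dist1(U₀(∂p)) ≤ εℓ⁻²` (`ℓ = L^{K−n}`, `0 < ε`, `10⁶L⁵ε ≤ 1`); `Q, G, S, Λ` the recursion families of record at `Y := pertVar U₀ W = WU₀* − 1`
(displayed, zero content); per-level bounds `μ_j` of the two-block masses `(d+2)L·Σ_{b∈N(c)}‖Y_j(b)‖` (`0 ≤ μ_j`, `72μ_j ≤ 1`, `3μ_j + 1/24 < δ₂`) with the (B6)-shape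
`7800·L³·ℓ·μ_j ≤ θ·Lʲ` and `1000·θ·L ≤ 1`.  THEN
`Σ_c‖Q^{(K−n)}Y(c)‖² ≤ 24ℓ·(200L⁴(Σ‖curl_{U₀}Y‖²_HS + Σ‖D^*_{U₀}Y‖²_HS) + 4·10⁹L⁹εℓ⁻²Σ‖Y‖²) + 10⁶L⁴θ²·ℓ⁻¹·Σ‖Y‖²`.
[cite: Balaban1985Averaging, Prop. 3 (122)-(126) p.36; Balaban1984PropagatorsI, (1.18)-(1.20) pp.19-20; Balaban1985BackgroundPropagators, Thm 3.11 p.416; Balaban1985Variational, (14)-(15) p.280, Prop. 7 p.299] -/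
theorem sum_normSq_trueLinIter_le_explicit_T3 (F : T3Family) (n K : ℕ)
    (U₀ W : GaugeField (F.P K) 0 (Matrix.specialUnitaryGroup (Fin 2) ℂ)) {ε : ℝ} (hε : 0 < ε) (hεL : 1000000 * (F.L : ℝ) ^ 5 * ε ≤ 1)
    (hU : ∀ p : Plaq (F.P K) 0, dist1 (GaugeField.plaqHol U₀ p) ≤ ε * (((F.L : ℝ) ^ (K - n)) ^ 2)⁻¹)
    (hfib : Averaging.iter (fun i => blockAvg (P := (F.P K)) (j := i) (expMeanLogSU (n := Fin 2))) (K - n) W = Averaging.iter (fun i => blockAvg (P := (F.P K)) (j := i) (expMeanLogSU (n := Fin 2))) (K - n) U₀)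
    (Q : (k : ℕ) → (PBond (F.P K) 0 → Matrix (Fin 2) (Fin 2) ℂ) → PBond (F.P K) k → Matrix (Fin 2) (Fin 2) ℂ) (hQ0 : ∀ Y, Q 0 Y = Y)
    (hQs : ∀ (k : ℕ) (Y : PBond (F.P K) 0 → Matrix (Fin 2) (Fin 2) ℂ) (c : PBond (F.P K) (k + 1)), Q (k + 1) Y c
      = (fderiv ℂ (eml : (Idx (F.P K) → Matrix (Fin 2) (Fin 2) ℂ) → Matrix (Fin 2) (Fin 2) ℂ)
            (fun i => ((loopHol (Averaging.iter (fun i => blockAvg (P := (F.P K)) (j := i) (expMeanLogSU (n := Fin 2))) k U₀) c i : Matrix.specialUnitaryGroup (Fin 2) ℂ) : Matrix (Fin 2) (Fin 2) ℂ))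
            (fun i => covWalkSum (Averaging.iter (fun i => blockAvg (P := (F.P K)) (j := i) (expMeanLogSU (n := Fin 2))) k U₀) (Q k Y) (walk (emb c.src) (loopWord (F.P K).L c.dir (off i.1) i.2.1 i.2.2))
              * ((loopHol (Averaging.iter (fun i => blockAvg (P := (F.P K)) (j := i) (expMeanLogSU (n := Fin 2))) k U₀) c i : Matrix.specialUnitaryGroup (Fin 2) ℂ) : Matrix (Fin 2) (Fin 2) ℂ))
            * star ((corr (expMeanLogSU (n := Fin 2)) (Averaging.iter (fun i => blockAvg (P := (F.P K)) (j := i) (expMeanLogSU (n := Fin 2))) k U₀) c : Matrix.specialUnitaryGroup (Fin 2) ℂ) : Matrix (Fin 2) (Fin 2) ℂ)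
          + ((corr (expMeanLogSU (n := Fin 2)) (Averaging.iter (fun i => blockAvg (P := (F.P K)) (j := i) (expMeanLogSU (n := Fin 2))) k U₀) c : Matrix.specialUnitaryGroup (Fin 2) ℂ) : Matrix (Fin 2) (Fin 2) ℂ)
            * covWalkSum (Averaging.iter (fun i => blockAvg (P := (F.P K)) (j := i) (expMeanLogSU (n := Fin 2))) k U₀) (Q k Y) (walk (emb c.src) (List.replicate (F.P K).L (c.dir, true)))
            * star ((corr (expMeanLogSU (n := Fin 2)) (Averaging.iter (fun i => blockAvg (P := (F.P K)) (j := i) (expMeanLogSU (n := Fin 2))) k U₀) c : Matrix.specialUnitaryGroup (Fin 2) ℂ) : Matrix (Fin 2) (Fin 2) ℂ)))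
    (G S : (k : ℕ) → PBond (F.P K) k → Matrix (Fin 2) (Fin 2) ℂ) (Λ : (k : ℕ) → Site (F.P K) k → Matrix (Fin 2) (Fin 2) ℂ)
    (hG0 : ∀ b, G 0 b = pertVar U₀ W b) (hS0 : ∀ b, S 0 b = pertVar U₀ W b) (hΛ0 : ∀ x, Λ 0 x = 0)
    (hΛs : ∀ (k : ℕ) (z : Site (F.P K) (k + 1)), Λ (k + 1) z
      = (((Fintype.card (Idx (F.P K)) : ℂ))⁻¹ • ∑ i : Idx (F.P K),
              covWalkSum (Averaging.iter (fun i => blockAvg (P := (F.P K)) (j := i) (expMeanLogSU (n := Fin 2))) k U₀) (G k) (walk (emb z) (stairWord i.2.1 (off i.1))))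
        + Λ k (emb z))
    (hGs : ∀ (k : ℕ) (c : PBond (F.P K) (k + 1)), G (k + 1) c
      = (fderiv ℂ (eml : (Idx (F.P K) → Matrix (Fin 2) (Fin 2) ℂ) → Matrix (Fin 2) (Fin 2) ℂ)
            (fun i => ((loopHol (Averaging.iter (fun i => blockAvg (P := (F.P K)) (j := i) (expMeanLogSU (n := Fin 2))) k U₀) c i : Matrix.specialUnitaryGroup (Fin 2) ℂ) : Matrix (Fin 2) (Fin 2) ℂ))
            (fun i => covWalkSum (Averaging.iter (fun i => blockAvg (P := (F.P K)) (j := i) (expMeanLogSU (n := Fin 2))) k U₀) (G k) (walk (emb c.src) (loopWord (F.P K).L c.dir (off i.1) i.2.1 i.2.2))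
              * ((loopHol (Averaging.iter (fun i => blockAvg (P := (F.P K)) (j := i) (expMeanLogSU (n := Fin 2))) k U₀) c i : Matrix.specialUnitaryGroup (Fin 2) ℂ) : Matrix (Fin 2) (Fin 2) ℂ))
            * star ((corr (expMeanLogSU (n := Fin 2)) (Averaging.iter (fun i => blockAvg (P := (F.P K)) (j := i) (expMeanLogSU (n := Fin 2))) k U₀) c : Matrix.specialUnitaryGroup (Fin 2) ℂ) : Matrix (Fin 2) (Fin 2) ℂ)
          + ((corr (expMeanLogSU (n := Fin 2)) (Averaging.iter (fun i => blockAvg (P := (F.P K)) (j := i) (expMeanLogSU (n := Fin 2))) k U₀) c : Matrix.specialUnitaryGroup (Fin 2) ℂ) : Matrix (Fin 2) (Fin 2) ℂ)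
            * covWalkSum (Averaging.iter (fun i => blockAvg (P := (F.P K)) (j := i) (expMeanLogSU (n := Fin 2))) k U₀) (G k) (walk (emb c.src) (List.replicate (F.P K).L (c.dir, true)))
            * star ((corr (expMeanLogSU (n := Fin 2)) (Averaging.iter (fun i => blockAvg (P := (F.P K)) (j := i) (expMeanLogSU (n := Fin 2))) k U₀) c : Matrix.specialUnitaryGroup (Fin 2) ℂ) : Matrix (Fin 2) (Fin 2) ℂ))
        - ((((Fintype.card (Idx (F.P K)) : ℂ))⁻¹ • ∑ i : Idx (F.P K),
              covWalkSum (Averaging.iter (fun i => blockAvg (P := (F.P K)) (j := i) (expMeanLogSU (n := Fin 2))) k U₀) (G k) (walk (emb c.src) (stairWord i.2.1 (off i.1))))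
            - ((Averaging.iter (fun i => blockAvg (P := (F.P K)) (j := i) (expMeanLogSU (n := Fin 2))) (k + 1) U₀ c : Matrix.specialUnitaryGroup (Fin 2) ℂ) : Matrix (Fin 2) (Fin 2) ℂ)
              * (((Fintype.card (Idx (F.P K)) : ℂ))⁻¹ • ∑ i : Idx (F.P K),
              covWalkSum (Averaging.iter (fun i => blockAvg (P := (F.P K)) (j := i) (expMeanLogSU (n := Fin 2))) k U₀) (G k) (walk (emb c.tgt) (stairWord i.2.1 (off i.1))))
              * star ((Averaging.iter (fun i => blockAvg (P := (F.P K)) (j := i) (expMeanLogSU (n := Fin 2))) (k + 1) U₀ c : Matrix.specialUnitaryGroup (Fin 2) ℂ) : Matrix (Fin 2) (Fin 2) ℂ)))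
    (hSs : ∀ (k : ℕ) (c : PBond (F.P K) (k + 1)), S (k + 1) c
      = ((Fintype.card (Idx (F.P K)) : ℂ))⁻¹ • ∑ i : Idx (F.P K),
          ((holAt (Averaging.iter (fun i => blockAvg (P := (F.P K)) (j := i) (expMeanLogSU (n := Fin 2))) k U₀) (walk (emb c.src) (stairWord i.2.1 (off i.1))) : Matrix.specialUnitaryGroup (Fin 2) ℂ) : Matrix (Fin 2) (Fin 2) ℂ) *
            covWalkSum (Averaging.iter (fun i => blockAvg (P := (F.P K)) (j := i) (expMeanLogSU (n := Fin 2))) k U₀) (S k)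
              (walk (walkEnd (emb c.src) (stairWord i.2.1 (off i.1))) (List.replicate (F.P K).L (c.dir, true))) *
          star ((holAt (Averaging.iter (fun i => blockAvg (P := (F.P K)) (j := i) (expMeanLogSU (n := Fin 2))) k U₀) (walk (emb c.src) (stairWord i.2.1 (off i.1))) : Matrix.specialUnitaryGroup (Fin 2) ℂ) : Matrix (Fin 2) (Fin 2) ℂ))
    (μ : ℕ → ℝ) (hμ0 : ∀ j < K - n, 0 ≤ μ j)
    (hμ : ∀ j < K - n, ∀ c : PBond (F.P K) (j + 1), ((((F.P K).d + 2) * (F.P K).L : ℕ) : ℝ) * ∑ b ∈ (univ.filter (fun b : PBond (F.P K) j => blockOf b.src = c.src ∨ blockOf b.src = c.tgt)), ‖(pertVar (Averaging.iter (fun i => blockAvg (P := (F.P K)) (j := i) (expMeanLogSU (n := Fin 2))) j U₀) (Averaging.iter (fun i => blockAvg (P := (F.P K)) (j := i) (expMeanLogSU (n := Fin 2))) j W)) b‖ ≤ μ j)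
    (hμ72 : ∀ j < K - n, 72 * μ j ≤ 1) (hμN : ∀ j < K - n, 3 * μ j + 1 / 24 < deltaSU (Fin 2))
    {θ : ℝ} (hθ0 : 0 ≤ θ) (hμθ : ∀ j < K - n, 7800 * (F.L : ℝ) ^ 3 * (F.L : ℝ) ^ (K - n) * μ j ≤ θ * (F.L : ℝ) ^ j)
    (hθL : 1000 * θ * (F.L : ℝ) ≤ 1) :
    ∑ c : PBond (F.P K) (K - n), ‖Q (K - n) (pertVar U₀ W) c‖ ^ 2
      ≤ 24 * ((F.L : ℝ) ^ (K - n)) * (200 * (F.L : ℝ) ^ 4 * ((∑ x : Site (F.P K) 0, ∑ μ : Fin (F.P K).d, ∑ ν : Fin (F.P K).d,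
            (if μ < ν then ∑ j : Fin 2, ∑ k : Fin 2,
              ‖(curl (torusT (F.P K) 0) (fun κ z => unitsField (toUField U₀) ⟨z, κ⟩) (fun κ z => pertVar U₀ W ⟨z, κ⟩) μ ν x) j k‖ ^ 2 else 0)) + (∑ x : Site (F.P K) 0, ∑ j : Fin 2, ∑ k : Fin 2,
            ‖(divB (torusT (F.P K) 0) (fun κ z => unitsField (toUField U₀) ⟨z, κ⟩) (fun κ z => pertVar U₀ W ⟨z, κ⟩) x) j k‖ ^ 2)) + 4 * 10 ^ 9 * (F.L : ℝ) ^ 9 * ε * (((F.L : ℝ) ^ (K - n)) ^ 2)⁻¹ * (∑ b : PBond (F.P K) 0, ‖pertVar U₀ W b‖ ^ 2))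
        + 1000000 * (F.L : ℝ) ^ 4 * θ ^ 2 * (((F.L : ℝ) ^ (K - n)))⁻¹ * (∑ b : PBond (F.P K) 0, ‖pertVar U₀ W b‖ ^ 2) := by
  -- T³ letters and the tower sizes (as in ✓ `…CurvedLandauCoreFibreT3`)
  have hL3 := three_le_L F
  have hLpos : (0 : ℝ) < (F.L : ℝ) := by linarith only [hL3]
  have hLF : (F.P K).L = F.L := rfl
  have hk : K - n ≤ (F.P K).m + (F.P K).K := by show K - n ≤ F.m + K; omega
  obtain ⟨-, hε3, hε2, hε24, -⟩ := smallness_T3 F K hε hεL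
  have hε' : 0 < 2 * ε := by linarith only [hε]
  have hU' : PlaqSmall (2 * ε * ((((F.P K).L : ℝ) ^ (K - n))⁻¹) ^ 2) U₀ := by
    refine plaqSmall_of_le_of_lt hU ?_
    rw [hLF, inv_pow]
    exact mul_lt_mul_of_pos_right (by linarith only [hε]) (inv_pos.mpr (by positivity))
  have hα := loop_size_geom (N := 2) (K - n) hε' hε3 hε2 hU'
  obtain ⟨hale, h24, hN⟩ := size_numerals (N := 2) (K - n) hε' hε2 hε24
  have ha0 : ∀ j : ℕ, (0 : ℝ) ≤ (((((F.P K).d + 2) * (F.P K).L : ℕ) : ℝ) ^ 2 / 2 * (2 * ε) * ((((F.P K).L : ℝ)) ^ (2 * j) / (((F.P K).L : ℝ)) ^ (2 * (K - n)))) := fun j => by positivity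
  have ha'0 : (0 : ℝ) ≤ 2 * (2 * ε) := by positivity
  have hV : ∀ j < K - n, ∀ q : Plaq (F.P K) j,
      dist1 (GaugeField.plaqHol (Averaging.iter (fun i => blockAvg (P := (F.P K)) (j := i) (expMeanLogSU (n := Fin 2))) j U₀) q) ≤ 2 * (2 * ε) :=
    fun j hj q => ((tower_plaq_lt (K - n) hε' hε3 hε2 hU' hj.le q).2).le
  obtain ⟨hρ0, hρ1, -, hρ2L⟩ := rho_facts F K
  obtain ⟨hD0, hD12, -⟩ := two_sqrt_d_facts F K
  -- the level rows (✓ `Prop7FibreLevelMass.sqrt_sum_normSq_levelRatio_le` at every level `l ≤ K − n`)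
  have hrec : ∀ l ≤ K - n, Real.sqrt (∑ b : PBond (F.P K) l, ‖(pertVar (Averaging.iter (fun i => blockAvg (P := (F.P K)) (j := i) (expMeanLogSU (n := Fin 2))) l U₀) (Averaging.iter (fun i => blockAvg (P := (F.P K)) (j := i) (expMeanLogSU (n := Fin 2))) l W)) b‖ ^ 2)
      ≤ Real.sqrt (((((F.P K).L : ℝ)) ^ (F.P K).d)⁻¹ * (((F.P K).L : ℝ)) ^ 2) ^ l * Real.exp ((159 * ((((F.P K).d + 2) * (F.P K).L : ℕ) : ℝ) * Real.sqrt (2 * (F.P K).d * (((F.P K).L : ℝ)) ^ (F.P K).d * (2 * (F.P K).d))) / Real.sqrt (((((F.P K).L : ℝ)) ^ (F.P K).d)⁻¹ * (((F.P K).L : ℝ)) ^ 2) * ∑ i ∈ Finset.range l, (((((F.P K).d + 2) * (F.P K).L : ℕ) : ℝ) ^ 2 / 2 * (2 * ε) * ((((F.P K).L : ℝ)) ^ (2 * i) / (((F.P K).L : ℝ)) ^ (2 * (K - n))))) * Real.sqrt (∑ b : PBond (F.P K) 0, ‖pertVar U₀ W b‖ ^ 2)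
        + 2 * Real.sqrt (F.P K).d * Real.sqrt (∑ y : Site (F.P K) l, ‖Λ l y‖ ^ 2)
        + (Real.exp ((159 * ((((F.P K).d + 2) * (F.P K).L : ℕ) : ℝ) * Real.sqrt (2 * (F.P K).d * (((F.P K).L : ℝ)) ^ (F.P K).d * (2 * (F.P K).d))) / Real.sqrt (((((F.P K).L : ℝ)) ^ (F.P K).d)⁻¹ * (((F.P K).L : ℝ)) ^ 2) * ∑ i ∈ Finset.range l, (((((F.P K).d + 2) * (F.P K).L : ℕ) : ℝ) ^ 2 / 2 * (2 * ε) * ((((F.P K).L : ℝ)) ^ (2 * i) / (((F.P K).L : ℝ)) ^ (2 * (K - n))))) * (∑ i ∈ Finset.range l, Real.sqrt (((((F.P K).L : ℝ)) ^ (F.P K).d)⁻¹ * (((F.P K).L : ℝ)) ^ 2) ^ (l - 1 - i) * (260 * (μ i * (((((F.P K).d + 2) * (F.P K).L : ℕ) : ℝ) * Real.sqrt (2 * (F.P K).d * (((F.P K).L : ℝ)) ^ (F.P K).d * (2 * (F.P K).d)) * Real.sqrt (∑ b : PBond (F.P K) i, ‖(pertVar (Averaging.iter (fun i => blockAvg (P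 := (F.P K)) (j := i) (expMeanLogSU (n := Fin 2))) i U₀) (Averaging.iter (fun i => blockAvg (P := (F.P K)) (j := i) (expMeanLogSU (n := Fin 2))) i W)) b‖ ^ 2)))))
        + 2 * Real.sqrt (F.P K).d * ∑ j ∈ Finset.range l, Real.sqrt (4 * (F.P K).d * ((((F.P K).d : ℝ) + 2) ^ 2 * (2 : ℕ) * (((F.P K).L : ℝ)) ^ 4) + (4 * (((F.P K).d : ℝ) + 2) ^ 2 * ((F.P K).d : ℝ) ^ 3 * (3 * (2 : ℕ) + 2 * (F.P K).d) * (((F.P K).L : ℝ)) ^ 6) * (2 * (2 * ε)) ^ 2) * (Real.exp ((159 * ((((F.P K).d + 2) * (F.P K).L : ℕ) : ℝ) * Real.sqrt (2 * (F.P K).d * (((F.P K).L : ℝ)) ^ (F.P K).d * (2 * (F.P K).d))) / Real.sqrt (((((F.P K).L : ℝ)) ^ (F.P K).d)⁻¹ * (((F.P K).L : ℝ)) ^ 2) * ∑ i ∈ Finset.range j, (((((F.P K).d + 2) * (F.P K).L : ℕ) : ℝ) ^ 2 / 2 * (2 * ε) * ((((F.P K).L : ℝ)) ^ (2 * i) /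 (((F.P K).L : ℝ)) ^ (2 * (K - n))))) * (∑ i ∈ Finset.range j, Real.sqrt (((((F.P K).L : ℝ)) ^ (F.P K).d)⁻¹ * (((F.P K).L : ℝ)) ^ 2) ^ (j - 1 - i) * (260 * (μ i * (((((F.P K).d + 2) * (F.P K).L : ℕ) : ℝ) * Real.sqrt (2 * (F.P K).d * (((F.P K).L : ℝ)) ^ (F.P K).d * (2 * (F.P K).d)) * Real.sqrt (∑ b : PBond (F.P K) i, ‖(pertVar (Averaging.iter (fun i => blockAvg (P := (F.P K)) (j := i) (expMeanLogSU (n := Fin 2))) i U₀) (Averaging.iter (fun i => blockAvg (P := (F.P K)) (j := i) (expMeanLogSU (n := Fin 2))) i W)) b‖ ^ 2))))))) := by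
    intro l hl
    exact sqrt_sum_normSq_levelRatio_le U₀ W (hl.trans hk) Q hQ0 hQs G S Λ hG0 hS0 hΛ0 hΛs hGs hSs (fun j => (((((F.P K).d + 2) * (F.P K).L : ℕ) : ℝ) ^ 2 / 2 * (2 * ε) * ((((F.P K).L : ℝ)) ^ (2 * j) / (((F.P K).L : ℝ)) ^ (2 * (K - n))))) ha0 ha'0
      (fun j hj => hα j (lt_of_lt_of_le hj hl)) (fun j hj => (hale j (lt_of_lt_of_le hj hl)).trans h24) (fun j hj => (hale j (lt_of_lt_of_le hj hl)).trans_lt hN)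
      (fun j hj => hV j (lt_of_lt_of_le hj hl)) μ (fun j hj => hμ0 j (lt_of_lt_of_le hj hl)) (fun j hj => hμ j (lt_of_lt_of_le hj hl))
      (fun j hj => hμ72 j (lt_of_lt_of_le hj hl)) (fun j hj => by linarith only [hμN j (lt_of_lt_of_le hj hl), (hale j (lt_of_lt_of_le hj hl)).trans h24])
  -- the scalar inputs of the induction
  have he : ∀ j ≤ K - n, 0 ≤ Real.exp ((159 * ((((F.P K).d + 2) * (F.P K).L : ℕ) : ℝ) * Real.sqrt (2 * (F.P K).d * (((F.P K).L : ℝ)) ^ (F.P K).d * (2 * (F.P K).d))) / Real.sqrt (((((F.P K).L : ℝ)) ^ (F.P K).d)⁻¹ * (((F.P K).L : ℝ)) ^ 2) * ∑ i ∈ Finset.range j, (((((F.P K).d + 2) * (F.P K).L : ℕ) : ℝ) ^ 2 / 2 * (2 * ε) * ((((F.P K).L : ℝ)) ^ (2 * i) / (((F.P K).L : ℝ)) ^ (2 * (K - n))))) ∧ Real.exp ((159 * ((((F.P K).d + 2) * (F.P K).L : ℕ) : ℝ) * Real.sqrt (2 * (F.P K).d * (((F.P K).L : ℝ)) ^ (F.P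 K).d * (2 * (F.P K).d))) / Real.sqrt (((((F.P K).L : ℝ)) ^ (F.P K).d)⁻¹ * (((F.P K).L : ℝ)) ^ 2) * ∑ i ∈ Finset.range j, (((((F.P K).d + 2) * (F.P K).L : ℕ) : ℝ) ^ 2 / 2 * (2 * ε) * ((((F.P K).L : ℝ)) ^ (2 * i) / (((F.P K).L : ℝ)) ^ (2 * (K - n))))) ≤ 3 / 2 :=
    fun j hj => ⟨(Real.exp_pos _).le, level_exp_le F n K hε hεL j hj⟩
  have hBsq0 : 0 ≤ (200 * (F.L : ℝ) ^ 4 * ((∑ x : Site (F.P K) 0, ∑ μ : Fin (F.P K).d, ∑ ν : Fin (F.P K).d,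
            (if μ < ν then ∑ j : Fin 2, ∑ k : Fin 2,
              ‖(curl (torusT (F.P K) 0) (fun κ z => unitsField (toUField U₀) ⟨z, κ⟩) (fun κ z => pertVar U₀ W ⟨z, κ⟩) μ ν x) j k‖ ^ 2 else 0)) + (∑ x : Site (F.P K) 0, ∑ j : Fin 2, ∑ k : Fin 2,
            ‖(divB (torusT (F.P K) 0) (fun κ z => unitsField (toUField U₀) ⟨z, κ⟩) (fun κ z => pertVar U₀ W ⟨z, κ⟩) x) j k‖ ^ 2)) + 4 * 10 ^ 9 * (F.L : ℝ) ^ 9 * ε * (((F.L : ℝ) ^ (K - n)) ^ 2)⁻¹ * (∑ b : PBond (F.P K) 0, ‖pertVar U₀ W b‖ ^ 2)) := by positivity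
  have hΛlev := sum_normSq_covIterLambda_le_level F n K U₀ hε hεL hU (pertVar U₀ W) G S Λ hΛ0 hG0 hS0 hΛs hGs hSs
  have hlam : ∀ l ≤ K - n, 0 ≤ Real.sqrt (∑ y : Site (F.P K) l, ‖Λ l y‖ ^ 2) ∧ Real.sqrt (((((F.P K).L : ℝ)) ^ (F.P K).d)⁻¹ * (((F.P K).L : ℝ)) ^ 2) ^ l * Real.sqrt (∑ y : Site (F.P K) l, ‖Λ l y‖ ^ 2) ≤ Real.sqrt (200 * (F.L : ℝ) ^ 4 * ((∑ x : Site (F.P K) 0, ∑ μ : Fin (F.P K).d, ∑ ν : Fin (F.P K).d,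
            (if μ < ν then ∑ j : Fin 2, ∑ k : Fin 2,
              ‖(curl (torusT (F.P K) 0) (fun κ z => unitsField (toUField U₀) ⟨z, κ⟩) (fun κ z => pertVar U₀ W ⟨z, κ⟩) μ ν x) j k‖ ^ 2 else 0)) + (∑ x : Site (F.P K) 0, ∑ j : Fin 2, ∑ k : Fin 2,
            ‖(divB (torusT (F.P K) 0) (fun κ z => unitsField (toUField U₀) ⟨z, κ⟩) (fun κ z => pertVar U₀ W ⟨z, κ⟩) x) j k‖ ^ 2)) + 4 * 10 ^ 9 * (F.L : ℝ) ^ 9 * ε * (((F.L : ℝ) ^ (K - n)) ^ 2)⁻¹ * (∑ b : PBond (F.P K) 0, ‖pertVar U₀ W b‖ ^ 2)) :=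
    fun l hl => ⟨Real.sqrt_nonneg _, rho_pow_mul_sqrt_le F K (Finset.sum_nonneg fun _ _ => sq_nonneg _) (hΛlev l hl)⟩
  have hC10 : 0 ≤ (((((F.P K).d + 2) * (F.P K).L : ℕ) : ℝ) * Real.sqrt (2 * (F.P K).d * (((F.P K).L : ℝ)) ^ (F.P K).d * (2 * (F.P K).d))) := by positivity
  have hμ' : ∀ l < K - n, 0 ≤ μ l ∧ 260 * (μ l * (((((F.P K).d + 2) * (F.P K).L : ℕ) : ℝ) * Real.sqrt (2 * (F.P K).d * (((F.P K).L : ℝ)) ^ (F.P K).d * (2 * (F.P K).d)))) ≤ θ * Real.sqrt (((((F.P K).L : ℝ)) ^ (F.P K).d)⁻¹ * (((F.P K).L : ℝ)) ^ 2) ^ (2 * ((K - n) - l)) :=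
    fun l hl => ⟨hμ0 l hl, coeff_of_B6 F n K hl.le (hμ0 l hl) (hμθ l hl)⟩
  have hsmall := theta_smallness F K hε hεL hθ0 hθL
  -- ★ the scalar induction
  obtain ⟨-, htop⟩ := levelMass_induction hρ0 hρ1 hθ0 (by norm_num : (0 : ℝ) ≤ 3 / 2) (Real.sqrt_nonneg _ : 0 ≤ Real.sqrt (4 * (F.P K).d * ((((F.P K).d : ℝ) + 2) ^ 2 * (2 : ℕ) * (((F.P K).L : ℝ)) ^ 4) + (4 * (((F.P K).d : ℝ) + 2) ^ 2 * ((F.P K).d : ℝ) ^ 3 * (3 * (2 : ℕ) + 2 * (F.P K).d) * (((F.P K).L : ℝ)) ^ 6) * (2 * (2 * ε)) ^ 2)) hD0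
    (Real.sqrt_nonneg _ : 0 ≤ Real.sqrt (200 * (F.L : ℝ) ^ 4 * ((∑ x : Site (F.P K) 0, ∑ μ : Fin (F.P K).d, ∑ ν : Fin (F.P K).d,
            (if μ < ν then ∑ j : Fin 2, ∑ k : Fin 2,
              ‖(curl (torusT (F.P K) 0) (fun κ z => unitsField (toUField U₀) ⟨z, κ⟩) (fun κ z => pertVar U₀ W ⟨z, κ⟩) μ ν x) j k‖ ^ 2 else 0)) + (∑ x : Site (F.P K) 0, ∑ j : Fin 2, ∑ k : Fin 2,
            ‖(divB (torusT (F.P K) 0) (fun κ z => unitsField (toUField U₀) ⟨z, κ⟩) (fun κ z => pertVar U₀ W ⟨z, κ⟩) x) j k‖ ^ 2)) + 4 * 10 ^ 9 * (F.L : ℝ) ^ 9 * ε * (((F.L : ℝ) ^ (K - n)) ^ 2)⁻¹ * (∑ b : PBond (F.P K) 0, ‖pertVar U₀ W b‖ ^ 2))) hC10 (Real.sqrt_nonneg _ : 0 ≤ Real.sqrt (∑ b : PBond (F.P K) 0, ‖pertVar U₀ W b‖ ^ 2)) (K - n)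
    (fun l => Real.sqrt (∑ b : PBond (F.P K) l, ‖(pertVar (Averaging.iter (fun i => blockAvg (P := (F.P K)) (j := i) (expMeanLogSU (n := Fin 2))) l U₀) (Averaging.iter (fun i => blockAvg (P := (F.P K)) (j := i) (expMeanLogSU (n := Fin 2))) l W)) b‖ ^ 2)) (fun j => Real.exp ((159 * ((((F.P K).d + 2) * (F.P K).L : ℕ) : ℝ) * Real.sqrt (2 * (F.P K).d * (((F.P K).L : ℝ)) ^ (F.P K).d * (2 * (F.P K).d))) / Real.sqrt (((((F.P K).L : ℝ)) ^ (F.P K).d)⁻¹ * (((F.P K).L : ℝ)) ^ 2) * ∑ i ∈ Finset.range j, (((((F.P K).d + 2) * (F.P K).L : ℕ) : ℝ) ^ 2 / 2 * (2 * ε) * ((((F.P K).L : ℝ)) ^ (2 * i) / (((F.P K).L : ℝ)) ^ (2 * (K - n)))))) (fun l => Real.sqrt (∑ y : Site (F.P K) l, ‖Λ l y‖ ^ 2)) μ (fun j => (∑ i ∈ Finset.range j, Real.sqrt (((((F.P K).L : ℝ)) ^ (F.P K).d)⁻¹ * (((F.P K).L : ℝ)) ^ 2) ^ (j - 1 - i)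 * (260 * (μ i * (((((F.P K).d + 2) * (F.P K).L : ℕ) : ℝ) * Real.sqrt (2 * (F.P K).d * (((F.P K).L : ℝ)) ^ (F.P K).d * (2 * (F.P K).d)) * Real.sqrt (∑ b : PBond (F.P K) i, ‖(pertVar (Averaging.iter (fun i => blockAvg (P := (F.P K)) (j := i) (expMeanLogSU (n := Fin 2))) i U₀) (Averaging.iter (fun i => blockAvg (P := (F.P K)) (j := i) (expMeanLogSU (n := Fin 2))) i W)) b‖ ^ 2))))))
    (fun l => Real.sqrt_nonneg _) he hlam hμ' (fun j => rfl) hrec hsmall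
  -- ★ the fibre: `√Z_Q ≤ E_kS_k + 2√dΣC_CM E_jS_j` (✓ file C)
  have hJ := sqrt_sum_normSq_trueLinIter_le_of_iter_eq_mass U₀ W hk hfib Q hQ0 hQs (fun j => (((((F.P K).d + 2) * (F.P K).L : ℕ) : ℝ) ^ 2 / 2 * (2 * ε) * ((((F.P K).L : ℝ)) ^ (2 * j) / (((F.P K).L : ℝ)) ^ (2 * (K - n))))) ha0 ha'0 hα
    (fun j hj => (hale j hj).trans h24) (fun j hj => (hale j hj).trans_lt hN) hV μ hμ0 hμ hμ72
    (fun j hj => by linarith only [hμN j hj, (hale j hj).trans h24])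
  -- combine: `Z_Q ≤ R²`, `ρᵏR ≤ W` ⟹ `Z_Q ≤ LᵏW²`, then the end-game numerals
  have hZ0 : 0 ≤ ∑ c : PBond (F.P K) (K - n), ‖Q (K - n) (pertVar U₀ W) c‖ ^ 2 := Finset.sum_nonneg fun _ _ => sq_nonneg _
  have hR0 : 0 ≤ Real.exp ((159 * ((((F.P K).d + 2) * (F.P K).L : ℕ) : ℝ) * Real.sqrt (2 * (F.P K).d * (((F.P K).L : ℝ)) ^ (F.P K).d * (2 * (F.P K).d))) / Real.sqrt (((((F.P K).L : ℝ)) ^ (F.P K).d)⁻¹ * (((F.P K).L : ℝ)) ^ 2) * ∑ i ∈ Finset.range (K - n), (((((F.P K).d + 2) * (F.P K).L : ℕ) : ℝ) ^ 2 / 2 * (2 * ε) * ((((F.P K).L : ℝ)) ^ (2 * i) / (((F.P K).L : ℝ)) ^ (2 * (K - n))))) * (∑ i ∈ Finset.range (K - n), Real.sqrt (((((F.P K).L : ℝ)) ^ (F.P K).d)⁻¹ * (((F.P K).L : ℝ)) ^ 2) ^ ((K - n) - 1 - i) * (260 * (μ i * (((((F.P K).d + 2) * (F.P K).L : ℕ)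 : ℝ) * Real.sqrt (2 * (F.P K).d * (((F.P K).L : ℝ)) ^ (F.P K).d * (2 * (F.P K).d)) * Real.sqrt (∑ b : PBond (F.P K) i, ‖(pertVar (Averaging.iter (fun i => blockAvg (P := (F.P K)) (j := i) (expMeanLogSU (n := Fin 2))) i U₀) (Averaging.iter (fun i => blockAvg (P := (F.P K)) (j := i) (expMeanLogSU (n := Fin 2))) i W)) b‖ ^ 2)))))
        + 2 * Real.sqrt (F.P K).d * ∑ j ∈ Finset.range (K - n), Real.sqrt (4 * (F.P K).d * ((((F.P K).d : ℝ) + 2) ^ 2 * (2 : ℕ) * (((F.P K).L : ℝ)) ^ 4) + (4 * (((F.P K).d : ℝ) + 2) ^ 2 * ((F.P K).d : ℝ) ^ 3 * (3 * (2 : ℕ) + 2 * (F.P K).d) * (((F.P K).L : ℝ)) ^ 6) * (2 * (2 * ε)) ^ 2) * (Real.exp ((159 * ((((F.P K).d + 2) * (F.P K).L : ℕ) : ℝ) * Real.sqrt (2 * (F.P K).d * (((F.P K).L : ℝ)) ^ (F.P K).d * (2 * (F.P K).d))) / Real.sqrt (((((F.P K).L : ℝ)) ^ (F.P K).d)⁻¹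 * (((F.P K).L : ℝ)) ^ 2) * ∑ i ∈ Finset.range j, (((((F.P K).d + 2) * (F.P K).L : ℕ) : ℝ) ^ 2 / 2 * (2 * ε) * ((((F.P K).L : ℝ)) ^ (2 * i) / (((F.P K).L : ℝ)) ^ (2 * (K - n))))) * (∑ i ∈ Finset.range j, Real.sqrt (((((F.P K).L : ℝ)) ^ (F.P K).d)⁻¹ * (((F.P K).L : ℝ)) ^ 2) ^ (j - 1 - i) * (260 * (μ i * (((((F.P K).d + 2) * (F.P K).L : ℕ) : ℝ) * Real.sqrt (2 * (F.P K).d * (((F.P K).L : ℝ)) ^ (F.P K).d * (2 * (F.P K).d)) * Real.sqrt (∑ b : PBond (F.P K) i, ‖(pertVar (Averaging.iter (fun i => blockAvg (P := (F.P K)) (j := i) (expMeanLogSU (n := Fin 2))) i U₀) (Averaging.iter (fun i => blockAvg (P := (F.P K)) (j := i) (expMeanLogSU (n := Fin 2))) i W)) b‖ ^ 2)))))) := le_trans (Real.sqrt_nonneg _) hJ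
  have hZR : ∑ c : PBond (F.P K) (K - n), ‖Q (K - n) (pertVar U₀ W) c‖ ^ 2 ≤ (Real.exp ((159 * ((((F.P K).d + 2) * (F.P K).L : ℕ) : ℝ) * Real.sqrt (2 * (F.P K).d * (((F.P K).L : ℝ)) ^ (F.P K).d * (2 * (F.P K).d))) / Real.sqrt (((((F.P K).L : ℝ)) ^ (F.P K).d)⁻¹ * (((F.P K).L : ℝ)) ^ 2) * ∑ i ∈ Finset.range (K - n), (((((F.P K).d + 2) * (F.P K).L : ℕ) : ℝ) ^ 2 / 2 * (2 * ε) * ((((F.P K).L : ℝ)) ^ (2 * i) / (((F.P K).L : ℝ)) ^ (2 * (K - n))))) * (∑ i ∈ Finset.range (K - n), Real.sqrt (((((F.P K).L : ℝ)) ^ (F.P K).d)⁻¹ * (((F.P K).L : ℝ)) ^ 2) ^ ((K - n) - 1 - i) * (260 * (μ i * (((((F.P K).d + 2) * (F.P K).L : ℕ) : ℝ) * Real.sqrt (2 * (F.P K).d * (((F.P K).L : ℝ)) ^ (F.P K).d * (2 * (F.P K).d)) * Real.sqrt (∑ b : PBond (F.P K) i, ‖(pertVar (Averaging.iter (fun i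 => blockAvg (P := (F.P K)) (j := i) (expMeanLogSU (n := Fin 2))) i U₀) (Averaging.iter (fun i => blockAvg (P := (F.P K)) (j := i) (expMeanLogSU (n := Fin 2))) i W)) b‖ ^ 2)))))
        + 2 * Real.sqrt (F.P K).d * ∑ j ∈ Finset.range (K - n), Real.sqrt (4 * (F.P K).d * ((((F.P K).d : ℝ) + 2) ^ 2 * (2 : ℕ) * (((F.P K).L : ℝ)) ^ 4) + (4 * (((F.P K).d : ℝ) + 2) ^ 2 * ((F.P K).d : ℝ) ^ 3 * (3 * (2 : ℕ) + 2 * (F.P K).d) * (((F.P K).L : ℝ)) ^ 6) * (2 * (2 * ε)) ^ 2) * (Real.exp ((159 * ((((F.P K).d + 2) * (F.P K).L : ℕ) : ℝ) * Real.sqrt (2 * (F.P K).d * (((F.P K).L : ℝ)) ^ (F.P K).d * (2 * (F.P K).d))) / Real.sqrt (((((F.P K).L : ℝ)) ^ (F.P K).d)⁻¹ * (((F.P K).L : ℝ)) ^ 2) * ∑ i ∈ Finset.range j, (((((F.P K).d + 2) * (F.P K).L : ℕ) : ℝ) ^ 2 / 2 * (2 * ε) * ((((F.P K).L : ℝ))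 ^ (2 * i) / (((F.P K).L : ℝ)) ^ (2 * (K - n))))) * (∑ i ∈ Finset.range j, Real.sqrt (((((F.P K).L : ℝ)) ^ (F.P K).d)⁻¹ * (((F.P K).L : ℝ)) ^ 2) ^ (j - 1 - i) * (260 * (μ i * (((((F.P K).d + 2) * (F.P K).L : ℕ) : ℝ) * Real.sqrt (2 * (F.P K).d * (((F.P K).L : ℝ)) ^ (F.P K).d * (2 * (F.P K).d)) * Real.sqrt (∑ b : PBond (F.P K) i, ‖(pertVar (Averaging.iter (fun i => blockAvg (P := (F.P K)) (j := i) (expMeanLogSU (n := Fin 2))) i U₀) (Averaging.iter (fun i => blockAvg (P := (F.P K)) (j := i) (expMeanLogSU (n := Fin 2))) i W)) b‖ ^ 2))))))) ^ 2 := by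
    have h1 := pow_le_pow_left₀ (Real.sqrt_nonneg _) hJ 2
    rwa [Real.sq_sqrt hZ0] at h1
  have hRW : (Real.exp ((159 * ((((F.P K).d + 2) * (F.P K).L : ℕ) : ℝ) * Real.sqrt (2 * (F.P K).d * (((F.P K).L : ℝ)) ^ (F.P K).d * (2 * (F.P K).d))) / Real.sqrt (((((F.P K).L : ℝ)) ^ (F.P K).d)⁻¹ * (((F.P K).L : ℝ)) ^ 2) * ∑ i ∈ Finset.range (K - n), (((((F.P K).d + 2) * (F.P K).L : ℕ) : ℝ) ^ 2 / 2 * (2 * ε) * ((((F.P K).L : ℝ)) ^ (2 * i) / (((F.P K).L : ℝ)) ^ (2 * (K - n))))) * (∑ i ∈ Finset.range (K - n), Real.sqrt (((((F.P K).L : ℝ)) ^ (F.P K).d)⁻¹ * (((F.P K).L : ℝ)) ^ 2) ^ ((K - n) - 1 - i) * (260 * (μ i * (((((F.P K).d + 2) * (F.P K).L : ℕ) : ℝ) * Real.sqrt (2 * (F.P K).d * (((F.P K).L : ℝ)) ^ (F.P K).d * (2 * (F.P K).d)) * Real.sqrt (∑ b : PBond (F.P K) i, ‖(pertVar (Averaging.iter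 (fun i => blockAvg (P := (F.P K)) (j := i) (expMeanLogSU (n := Fin 2))) i U₀) (Averaging.iter (fun i => blockAvg (P := (F.P K)) (j := i) (expMeanLogSU (n := Fin 2))) i W)) b‖ ^ 2)))))
        + 2 * Real.sqrt (F.P K).d * ∑ j ∈ Finset.range (K - n), Real.sqrt (4 * (F.P K).d * ((((F.P K).d : ℝ) + 2) ^ 2 * (2 : ℕ) * (((F.P K).L : ℝ)) ^ 4) + (4 * (((F.P K).d : ℝ) + 2) ^ 2 * ((F.P K).d : ℝ) ^ 3 * (3 * (2 : ℕ) + 2 * (F.P K).d) * (((F.P K).L : ℝ)) ^ 6) * (2 * (2 * ε)) ^ 2) * (Real.exp ((159 * ((((F.P K).d + 2) * (F.P K).L : ℕ) : ℝ) * Real.sqrt (2 * (F.P K).d * (((F.P K).L : ℝ)) ^ (F.P K).d * (2 * (F.P K).d))) / Real.sqrt (((((F.P K).L : ℝ)) ^ (F.P K).d)⁻¹ * (((F.P K).L : ℝ)) ^ 2) * ∑ i ∈ Finset.range j, (((((F.P K).d + 2) * (F.P K).L : ℕ) : ℝ) ^ 2 / 2 * (2 * ε) * ((((F.P K).L : ℝ))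 ^ (2 * i) / (((F.P K).L : ℝ)) ^ (2 * (K - n))))) * (∑ i ∈ Finset.range j, Real.sqrt (((((F.P K).L : ℝ)) ^ (F.P K).d)⁻¹ * (((F.P K).L : ℝ)) ^ 2) ^ (j - 1 - i) * (260 * (μ i * (((((F.P K).d + 2) * (F.P K).L : ℕ) : ℝ) * Real.sqrt (2 * (F.P K).d * (((F.P K).L : ℝ)) ^ (F.P K).d * (2 * (F.P K).d)) * Real.sqrt (∑ b : PBond (F.P K) i, ‖(pertVar (Averaging.iter (fun i => blockAvg (P := (F.P K)) (j := i) (expMeanLogSU (n := Fin 2))) i U₀) (Averaging.iter (fun i => blockAvg (P := (F.P K)) (j := i) (expMeanLogSU (n := Fin 2))) i W)) b‖ ^ 2))))))) ^ 2 ≤ (F.L : ℝ) ^ (K - n) * (2 * Real.sqrt (F.P K).d * Real.sqrt (200 * (F.L : ℝ) ^ 4 * ((∑ x : Site (F.P K) 0, ∑ μ : Fin (F.P K).d, ∑ ν : Fin (F.P K).d,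
            (if μ < ν then ∑ j : Fin 2, ∑ k : Fin 2,
              ‖(curl (torusT (F.P K) 0) (fun κ z => unitsField (toUField U₀) ⟨z, κ⟩) (fun κ z => pertVar U₀ W ⟨z, κ⟩) μ ν x) j k‖ ^ 2 else 0)) + (∑ x : Site (F.P K) 0, ∑ j : Fin 2, ∑ k : Fin 2,
            ‖(divB (torusT (F.P K) 0) (fun κ z => unitsField (toUField U₀) ⟨z, κ⟩) (fun κ z => pertVar U₀ W ⟨z, κ⟩) x) j k‖ ^ 2)) + 4 * 10 ^ 9 * (F.L : ℝ) ^ 9 * ε * (((F.L : ℝ) ^ (K - n)) ^ 2)⁻¹ * (∑ b : PBond (F.P K) 0, ‖pertVar U₀ W b‖ ^ 2))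
          + 2 * (θ * (3 / 2) * (1 + 2 * Real.sqrt (F.P K).d * Real.sqrt (4 * (F.P K).d * ((((F.P K).d : ℝ) + 2) ^ 2 * (2 : ℕ) * (((F.P K).L : ℝ)) ^ 4) + (4 * (((F.P K).d : ℝ) + 2) ^ 2 * ((F.P K).d : ℝ) ^ 3 * (3 * (2 : ℕ) + 2 * (F.P K).d) * (((F.P K).L : ℝ)) ^ 6) * (2 * (2 * ε)) ^ 2) * (Real.sqrt (((((F.P K).L : ℝ)) ^ (F.P K).d)⁻¹ * (((F.P K).L : ℝ)) ^ 2) / (1 - Real.sqrt (((((F.P K).L : ℝ)) ^ (F.P K).d)⁻¹ * (((F.P K).L : ℝ)) ^ 2)))) * ((3 / 2) * Real.sqrt (∑ b : PBond (F.P K) 0, ‖pertVar U₀ W b‖ ^ 2) * Real.sqrt (((((F.P K).L : ℝ)) ^ (F.P K).d)⁻¹ * (((F.P K).L : ℝ)) ^ 2) ^ (2 * (K - n) + 1) / (1 - Real.sqrt (((((F.P K).L : ℝ)) ^ (F.P K).d)⁻¹ * (((F.P K).L : ℝ)) ^ 2) ^ 2)))) ^ 2 :=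
    sq_le_of_rho_pow_mul_le F K (K - n) hR0 htop
  have hm0 : 0 ≤ (∑ b : PBond (F.P K) 0, ‖pertVar U₀ W b‖ ^ 2) := Finset.sum_nonneg fun _ _ => sq_nonneg _
  have hend := endgame θ (Real.sqrt (∑ b : PBond (F.P K) 0, ‖pertVar U₀ W b‖ ^ 2)) (K - n) hL3 hρ2L hD12 (K0_nonneg F K (ε := ε)) (K0_le F K hε hεL) hBsq0
  rw [Real.sq_sqrt hm0] at hend
  linarith only [hZR, hRW, hend]

end Summit.QuantumFields.YangMills.Theorems.Prop7FibreLevelMassT3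

end
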